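import Mathlib
import Summits.ValiantsHypothesis.ValiantsHypothesis.Theorems.BarrierLeverPartitionMinorsHitByVPHiddenStatesMemberBound

/-!
# Route BarrierLever — item `PartitionMinorsHitByVP` (stmt-ValiantsHypothesis-19717), line `hidden-states`:
# THE PROFILE BOUND (N_j) — rows of size `< j` see only the members with `< j` states

Helper file (`--supports stmt-ValiantsHypothesis-19717`; cell valiant-natproofs, rung V4, 𝒟-side door (c), registered line
`Cruxes/PartitionMinorsHitByVP/Lines/hidden_states.lean` v2, lane `stub_universalJoinWide`; prover seat val-np-p3 gen 10).
Definition-free, Mathlib + `…HiddenStatesMemberBound` only. Closes NO item: the second structural NEGATIVE about join families,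
the necessary PROFILE CONDITION (N_j) of memo val-np-p3 g10 §4, which explains every failure seen in the h = 12 window census
(kit j292782–j292790: the 16 BAD (family, design) pairs are exactly the designs violating (N_j), with corank = the (N_j) deficit).

THE POINT. On a row `U` with `|U| < j`, the entry of the column `(p, J)` is `g(J) = ∏_{a∈U}(c_a + Σ_{q∈J} s_{q,a})`, a function of the
member `J` whose Boolean-lattice Möbius transform vanishes above degree `|U|` (`MemberBound.alt_sum_prod_eq_zero`). Truncated Möbius
inversion (`moebius_trunc`) therefore writes `g(J)` as an explicit signed combination of the values `g(S)`, `S ⊆ J`, `|S| < j` — and in a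
down-closed (e.g. strict-threshold) family those `(p, S)` ARE columns. So, restricted to the SMALL rows (size `< j`), every column lies
in the span of the SMALL columns (members with `< j` states): if there are fewer small columns than small rows, the small rows are
linearly dependent and the block-additive matrix is singular for EVERY table (`det_eq_zero_of_profile`).

CONSEQUENCE (`smallRows_le_smallMembers_of_good`, condition (N_j)): a join threshold family that is good against a row family `u` has,
for every `j`, at least as many members with `< j` states as `u` has rows of size `< j`. For a universal family at `(h, r)` tested against
a bottom-heavy `u ⊇ B_{j−1}([h])`: `#{members with < j states} ≥ min(r, |B_{j−1}(h)|)` — the design must carry the Hamming-ball profile of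
`[h]` (which is why greedy designs take the ball on all `h` coordinates first, and why two balls on `h−1` states fail at r = 3798, 4018).
(`j = t+1` with all rows of size `≤ t` is the member-size bound (T) of `…HiddenStatesMemberBound`.)

WHAT THIS IS NOT: necessary, not sufficient (the single-cube star / 2-skeleton obstructions violate neither (T) nor (N_j)); item 19717 OPEN;
nothing on crux 14610 or VP ≠ VNP.
-/

set_option linter.dupNamespace false

namespace Summit.ValiantsHypothesis.ValiantsHypothesis.Theorems.BarrierLever.HiddenStates

open Finset Matrix

noncomputable section

namespace ProfileBound

variable {K : ℕ}

/-! ## 1. Truncated Möbius inversion on the Boolean lattice -/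

/-- The inner alternating sum over the interval `[S, J]`: `Σ_{S ⊆ T ⊆ J} (−1)^{|T|} = (−1)^{|S|}·[S = J]` (for `S ⊆ J`). -/
theorem sum_interval_neg_one_pow (S J : Finset (Fin K)) (hSJ : S ⊆ J) :
    ∑ T ∈ J.powerset.filter (fun T => S ⊆ T), (-1 : ℂ) ^ T.card = if S = J then (-1 : ℂ) ^ S.card else 0 := by
  classical
  -- reindex T = S ∪ T'' with T'' ⊆ J \ S
  have hre : ∑ T ∈ J.powerset.filter (fun T => S ⊆ T), (-1 : ℂ) ^ T.card
      = ∑ T'' ∈ (J \ S).powerset, (-1 : ℂ) ^ (S ∪ T'').card := by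
    refine Finset.sum_nbij' (fun T => T \ S) (fun T'' => S ∪ T'') ?_ ?_ ?_ ?_ ?_
    · intro T hT
      rw [Finset.mem_filter, Finset.mem_powerset] at hT
      exact Finset.mem_powerset.mpr (Finset.sdiff_subset_sdiff hT.1 (subset_refl S))
    · intro T'' hT''
      rw [Finset.mem_powerset] at hT''
      rw [Finset.mem_filter, Finset.mem_powerset]
      exact ⟨Finset.union_subset hSJ (hT''.trans Finset.sdiff_subset), Finset.subset_union_left⟩
    · intro T hT
      rw [Finset.mem_filter] at hT
      exact Finset.union_sdiff_of_subset hT.2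
    · intro T'' hT''
      rw [Finset.mem_powerset] at hT''
      rw [Finset.union_sdiff_left]
      exact Finset.sdiff_eq_self_of_disjoint (Finset.disjoint_of_subset_left hT'' Finset.sdiff_disjoint)
    · intro T hT
      rw [Finset.mem_filter] at hT
      rw [Finset.union_sdiff_of_subset hT.2]
  rw [hre]
  have hcard : ∀ T'' ∈ (J \ S).powerset, (S ∪ T'').card = S.card + T''.card := fun T'' hT'' =>
    Finset.card_union_of_disjoint (Finset.disjoint_of_subset_right (Finset.mem_powerset.mp hT'') Finset.disjoint_sdiff)
  rw [Finset.sum_congr rfl fun T'' hT'' => by rw [hcard T'' hT'', pow_add], ← Finset.mul_sum]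
  have hz : ∑ T'' ∈ (J \ S).powerset, (-1 : ℂ) ^ T''.card = if J \ S = ∅ then 1 else 0 := by
    have := Finset.sum_powerset_neg_one_pow_card (x := J \ S)
    split_ifs at this ⊢ <;> exact_mod_cast this
  rw [hz]
  by_cases hS : S = J
  · subst hS; simp
  · have : J \ S ≠ ∅ := fun h0 => hS (Finset.Subset.antisymm hSJ (Finset.sdiff_eq_empty_iff_subset.mp h0))
    rw [if_neg this, if_neg hS, mul_zero]

/-- **Truncated Möbius inversion.** If the alternating sums of `g` over every subcube of `J` of dimension `≥ j` vanish, then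
`g(J) = Σ_{T ⊆ J, |T| < j} (−1)^{|T|} Σ_{S ⊆ T} (−1)^{|S|} g(S)`. -/
theorem moebius_trunc (g : Finset (Fin K) → ℂ) (J : Finset (Fin K)) (j : ℕ)
    (hzero : ∀ T ⊆ J, j ≤ T.card → ∑ S ∈ T.powerset, (-1 : ℂ) ^ S.card * g S = 0) :
    g J = ∑ T ∈ J.powerset.filter (fun T => T.card < j), (-1 : ℂ) ^ T.card * ∑ S ∈ T.powerset, (-1 : ℂ) ^ S.card * g S := by
  classical
  -- first the full inversion over all T ⊆ J
  have hfull : ∑ T ∈ J.powerset, (-1 : ℂ) ^ T.card * ∑ S ∈ T.powerset, (-1 : ℂ) ^ S.card * g S = g J := by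
    simp_rw [Finset.mul_sum]
    rw [Finset.sum_comm' (t' := J.powerset) (s' := fun S => J.powerset.filter (fun T => S ⊆ T)) (fun T S => ?side)]
    case side =>
      simp only [Finset.mem_powerset, Finset.mem_filter]
      constructor
      · rintro ⟨hT, hS⟩; exact ⟨⟨hT, hS⟩, hS.trans hT⟩
      · rintro ⟨⟨hT, hS⟩, _⟩; exact ⟨hT, hS⟩
    have hinner : ∀ S ∈ J.powerset, ∑ T ∈ J.powerset.filter (fun T => S ⊆ T), (-1 : ℂ) ^ T.card * ((-1 : ℂ) ^ S.card * g S)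
        = (if S = J then (-1 : ℂ) ^ S.card else 0) * ((-1 : ℂ) ^ S.card * g S) := by
      intro S hS
      rw [← Finset.sum_mul, sum_interval_neg_one_pow S J (Finset.mem_powerset.mp hS)]
    rw [Finset.sum_congr rfl hinner, Finset.sum_eq_single J]
    · rw [if_pos rfl, ← mul_assoc, ← pow_add, ← two_mul, pow_mul]
      norm_num
    · intro S _ hSJ; rw [if_neg hSJ, zero_mul]
    · intro hJ; exact absurd (Finset.mem_powerset.mpr (subset_refl J)) hJ
  rw [← hfull, ← Finset.sum_filter_add_sum_filter_not J.powerset (fun T => T.card < j)]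
  rw [Finset.sum_eq_zero (s := J.powerset.filter fun T => ¬ T.card < j) (fun T hT => ?_), add_zero]
  rw [Finset.mem_filter, Finset.mem_powerset] at hT
  rw [hzero T hT.1 (Nat.le_of_not_lt hT.2), mul_zero]

/-! ## 2. Small rows are spanned by small columns -/

variable {h m r : ℕ}

/-- **THE PROFILE BOUND.** Let `e` be down-closed (every subset of a member is a member of the same piece; injectivity is not even
needed). If, for some `j`, the family has FEWER members with `< j` states than `u` has rows of size `< j`, then the block-additive matrix
is singular for every table. -/
theorem det_eq_zero_of_profile (u : Fin r → Finset (Fin h)) (j : ℕ)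
    (e : Fin r → Fin m × Finset (Fin K))
    (hdown : ∀ k S, S ⊆ (e k).2 → ((e k).1, S) ∈ Set.range e)
    (hcount : (Finset.univ.filter fun k => ((e k).2).card < j).card < (Finset.univ.filter fun i => (u i).card < j).card)
    (tx : Fin m → Option (Fin K) → Fin h → ℂ) :
    (Matrix.of fun i k : Fin r =>
      ∏ a ∈ u i, (tx (e k).1 none a + ∑ q ∈ (e k).2, tx (e k).1 (some q) a)).det = 0 := by
  classical
  set M : Matrix (Fin r) (Fin r) ℂ := Matrix.of fun i k : Fin r =>
    ∏ a ∈ u i, (tx (e k).1 none a + ∑ q ∈ (e k).2, tx (e k).1 (some q) a) with hM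
  -- small rows and small columns as subtypes
  let Is := {i : Fin r // (u i).card < j}
  let Cs := {k : Fin r // ((e k).2).card < j}
  have hcard : Fintype.card Cs < Fintype.card Is := by
    simpa [Is, Cs, Fintype.card_subtype] using hcount
  -- columns restricted to the small rows
  let col : Fin r → (Is → ℂ) := fun k i => M i.1 k
  let W : Submodule ℂ (Is → ℂ) := Submodule.span ℂ (Set.range fun k' : Cs => col k'.1)
  -- the column of a sub-member (p, S) of column k
  have hsub : ∀ k (S : Finset (Fin K)), S ⊆ (e k).2 → ∃ k', e k' = ((e k).1, S) := fun k S hS => hdown k S hS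
  choose! kof hkof using hsub
  -- every column is in W (restricted to small rows)
  have hmem : ∀ k, col k ∈ W := by
    intro k
    set p := (e k).1 with hp
    set J := (e k).2 with hJ
    let g : Is → Finset (Fin K) → ℂ := fun i S => ∏ a ∈ u i.1, (tx p none a + ∑ q ∈ S, tx p (some q) a)
    have hcolS : ∀ S, S ⊆ J → ∀ i : Is, g i S = col (kof k S) i := by
      intro S hS i
      show g i S = M i.1 (kof k S)
      simp only [hM, Matrix.of_apply, hkof k S hS, g, hp]
    -- Möbius expansion of col k, coordinatewise
    have hexp : col k = ∑ T ∈ J.powerset.filter (fun T => T.card < j),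
        (-1 : ℂ) ^ T.card • ∑ S ∈ T.powerset, (-1 : ℂ) ^ S.card • col (kof k S) := by
      funext i
      have hz : ∀ T ⊆ J, j ≤ T.card → ∑ S ∈ T.powerset, (-1 : ℂ) ^ S.card * g i S = 0 := by
        intro T _ hjT
        exact MemberBound.alt_sum_prod_eq_zero (fun q a => tx p (some q) a) (j - 1) (u i.1) (fun a => tx p none a) T
          (by have := i.2; omega) (by have := i.2; omega)
      have := moebius_trunc (g i) J j hz
      simp only [Finset.sum_apply, Pi.smul_apply, smul_eq_mul]
      rw [show col k i = g i J by simp only [hM, Matrix.of_apply, col, g, hp, hJ], this]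
      refine Finset.sum_congr rfl fun T hT => ?_
      congr 1
      refine Finset.sum_congr rfl fun S hS => ?_
      have hTJ : T ⊆ J := Finset.mem_powerset.mp (Finset.mem_filter.mp hT).1
      rw [hcolS S ((Finset.mem_powerset.mp hS).trans hTJ) i]
    rw [hexp]
    refine Submodule.sum_mem _ fun T hT => Submodule.smul_mem _ _ (Submodule.sum_mem _ fun S hS => Submodule.smul_mem _ _ ?_)
    have hTJ : T ⊆ J := Finset.mem_powerset.mp (Finset.mem_filter.mp hT).1
    have hSJ : S ⊆ J := (Finset.mem_powerset.mp hS).trans hTJ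
    have hsmall : ((e (kof k S)).2).card < j := by
      rw [hkof k S hSJ]
      exact lt_of_le_of_lt (Finset.card_le_card (Finset.mem_powerset.mp hS)) (Finset.mem_filter.mp hT).2
    exact Submodule.subset_span ⟨⟨kof k S, hsmall⟩, rfl⟩
  -- W is a proper subspace
  have hWlt : W < ⊤ := by
    have h1 : Module.finrank ℂ W ≤ Fintype.card Cs := finrank_range_le_card _
    have h3 : Module.finrank ℂ (Is → ℂ) = Fintype.card Is := Module.finrank_fintype_fun_eq_card ℂ
    exact Submodule.lt_top_of_finrank_lt_finrank (by omega)
  -- a nonzero functional killing W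
  obtain ⟨φ, hφ, hφW⟩ := Submodule.exists_dual_map_eq_bot_of_lt_top hWlt inferInstance
  have hφcol : ∀ k, φ (col k) = 0 := fun k => by
    have : φ (col k) ∈ W.map φ := Submodule.mem_map_of_mem (hmem k)
    rw [hφW] at this
    exact (Submodule.mem_bot ℂ).mp this
  -- the row vector
  let v : Fin r → ℂ := fun i => if hi : (u i).card < j then φ (fun i' : Is => if (⟨i, hi⟩ : Is) = i' then 1 else 0) else 0
  have hv : v ≠ 0 := by
    intro hv0
    apply hφ
    apply (Pi.basisFun ℂ Is).ext
    intro i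
    rw [LinearMap.zero_apply, Pi.basisFun_apply]
    have := congrFun hv0 i.1
    simp only [v, dif_pos i.2, Pi.zero_apply] at this
    convert this using 2
    funext i'
    simp [Pi.single_apply, eq_comm]
  refine Matrix.exists_vecMul_eq_zero_iff.mp ⟨v, hv, ?_⟩
  funext k
  rw [Matrix.vecMul, dotProduct, Pi.zero_apply]
  -- Σ_i v i * M i k = φ (col k) = 0
  have hsplit : ∑ i, v i * M i k = ∑ i ∈ Finset.univ.filter (fun i => (u i).card < j), v i * M i k := by
    rw [Finset.sum_filter]
    refine Finset.sum_congr rfl fun i _ => ?_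
    by_cases hi : (u i).card < j
    · rw [if_pos hi]
    · simp only [v, dif_neg hi, zero_mul, if_neg hi]
  rw [hsplit, Finset.sum_subtype (Finset.univ.filter fun i => (u i).card < j) (p := fun i => (u i).card < j)
    (fun i => by simp)]
  have hφexp := LinearMap.pi_apply_eq_sum_univ φ (col k)
  rw [hφcol k] at hφexp
  rw [hφexp]
  refine Finset.sum_congr rfl fun i _ => ?_
  simp only [v, dif_pos i.2, smul_eq_mul]
  ring

/-! ## 3. Packaged for the line's families -/

/-- **Necessary condition (N_j) for the join stubs.** Let `e` be a strict threshold join family (the shape quantified in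
`Stmt.stub_universalJoinWide` / `Stmt.stub_qjoinSharp`) which is good against the row family `u` (some table gives a nonsingular
block-additive matrix). Then for every `j`, `u` has at most as many rows of size `< j` as the family has members with `< j` states. -/
theorem smallRows_le_smallMembers_of_good (u : Fin r → Finset (Fin h)) (j : ℕ)
    (e : Fin r → Fin m × Finset (Fin K)) (W : Fin m → ℕ) (wt : Fin m → Fin K → ℕ)
    (hthr : ∀ x : Fin m × Finset (Fin K), x ∉ Set.range e →
      ∀ i, W (e i).1 + ∑ k ∈ (e i).2, wt (e i).1 k < W x.1 + ∑ k ∈ x.2, wt x.1 k)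
    (hgood : ∃ tx : Fin m → Option (Fin K) → Fin h → ℂ,
      (Matrix.of fun i k : Fin r =>
        ∏ a ∈ u i, (tx (e k).1 none a + ∑ q ∈ (e k).2, tx (e k).1 (some q) a)).det ≠ 0) :
    (Finset.univ.filter fun i => (u i).card < j).card ≤ (Finset.univ.filter fun k => ((e k).2).card < j).card := by
  by_contra hlt
  push Not at hlt
  obtain ⟨tx, htx⟩ := hgood
  exact htx (det_eq_zero_of_profile u j e (fun k S hS => MemberBound.mem_range_of_subset e W wt hthr k S hS) hlt tx)

end ProfileBound

end

end Summit.ValiantsHypothesis.ValiantsHypothesis.Theorems.BarrierLever.HiddenStates
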